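import Mathlib
import HarnessLib
import Summits.Langlands.Langlands.Theses.SkinnerWilesDefectOne
import Summits.Langlands.Langlands.Theorems.ReducibleOrdinaryProModular.Negative.LevelAndRamification
import Summits.Langlands.Langlands.Theorems.SkinnerWilesDefectOneReducibleOrdinaryProModularDefs
import Summits.Langlands.Langlands.Theorems.SkinnerWilesDefectOneReducibleOrdinaryProModularFineSelmerDefs
import Summits.Langlands.Langlands.Theorems.SkinnerWilesDefectOneReducibleOrdinaryProModularPatchingPrimeSupply
import Summits.Langlands.Langlands.Theorems.SkinnerWilesDefectOneReducibleOrdinaryProModularRaynaudConnectivityAux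
import Summits.Langlands.Langlands.Theorems.SkinnerWilesDefectOneReducibleOrdinaryProModularOrientedLocalDatum
import Summits.Langlands.Langlands.Theorems.SkinnerWilesDefectOneReducibleOrdinaryProModularIharaCrossingSpecialisationAux
import Summits.Langlands.Langlands.Theorems.SkinnerWilesDefectOneReducibleOrdinaryProModularIharaCrossingDivisorAux
import Summits.Langlands.Langlands.Theorems.SkinnerWilesDefectOneProModularOfEisensteinSeedProModularPrimes
import Summits.Langlands.Langlands.Theorems.SkinnerWilesDefectOneProModularOfEisensteinSeedProModularEntrance
import Summits.Langlands.Langlands.Theorems.SkinnerWilesDefectOneProModularOfEisensteinSeedPropagationSkeleton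
import Summits.Langlands.Langlands.Theorems.SkinnerWilesDefectOneReducibleOrdinaryProModularSeedPatchingPrimeLattice
import Summits.Langlands.Langlands.Theorems.SkinnerWilesDefectOneReducibleOrdinaryProModularCMPresentationReduction
import Summits.Langlands.Langlands.Theorems.SkinnerWilesDefectOneReducibleOrdinaryProModularRaynaudConnectedness
import Literature.NumberTheory.GaloisRepresentations.NearlyOrdinaryDeformationRing

/-!
# Line `fine-selmer-codimension-two` for the crux `SkinnerWilesDefectOne.ReducibleOrdinaryProModular`
(stmt-Langlands-12919) — LEAD SKELETON v8 (c3 2026-08-16: **(R) `stub_raynaudConnectedness` LANDED p122088 — Grothendieck SGA 2 XIII 2.1 PROVED in the tree, `Theorems.GrothendieckConnectedness_holds` p121706** — and imported; X2 PROVED from the Literature-debt stub X2⁰ `stub_nearlyOrdinaryPresentation` (Böckle Thm 7.6, p119922/p119923); v6: P2 proved from the new residual-transport stub P2' via p120508; X2/S5 regime clause := `H⁰(G_F, ad ρ̄ ⊗ ω̄) = 0` per Böckle Thm 7.6; 6 open stubs S2 P2' X2⁰ B P1 S5; earlier: prover-line-stmt-Langlands-12919-1, lead gen 1, 2026-08-16;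 v3 = v2.1 with the vocabulary
file LANDED (p97006) and imported, and (supply) `stub_patchingPrimeSupply` LANDED (p105384) and used by name: 6 open stubs)

v1 = the planner's checked skeleton `Cruxes/…/Lines/fine_selmer_codimension_two.lean` (5 stubs S1–S5 over a
line-private bundle `SWContext`).  v2 keeps the line's composition idea VERBATIM — realise `ρ` as a point of a
transverse Skinner–Wiles deformation ring; in the regime `r₀ ≤ 2` the LEVER (two-variable Iwasawa theory of the
fine Selmer module) makes the reducible locus small; Skinner–Wiles steps (II)–(III) then produce a nice prime and
step (I) (defect-one patching) makes `ρ` pro-modular; an honest complement-regime stub — and changes three things: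

1. VOCABULARY.  Everything is re-typed over the crux's LANDED vocabulary
   `Theorems/SkinnerWilesDefectOneReducibleOrdinaryProModularDefs.lean` (`OrdLoc`, `ProMod`, `crux_iff`, `ModelData`,
   `ModelData.Models`, `ModelData.IsLocalPoint`, `baseLevel`, `IsProModularPrimeAt`, `ClosedPointStratumLE`,
   `HasFiniteOrderRatio`) instead of the parallel `SWContext`; consequently S1 `stub_swRealisation` IS the landed
   `stub_orientedLocalDatum` (p91095) and is no longer a stub, and the steps can consume item stmt-Langlands-14718's
   landed lemmas (`IsProModularPrimeAt.of_le`, `isProModularPrimeAt_ker_of_isPadicallyAutomorphic`,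
   `ModelData.Models.proMod_of_isProModularPrimeAt_le`, `Theorems.proMod_of_propagation`).
2. THE LEVER'S REGIME (stub-misstated repair, lead gen 0's aligned-place count transferred to the base level): the
   fixed point `Ψ⁺ = ν̃ε` of the residual ratio carries a reducible type-`𝒟` family of Krull dimension `t + 1`
   (`t` = number of ALIGNED places of the datum: `v ∈ S`, `v ∤ p`, `Ψ̄|_{D_v} = ω|_{D_v}`), and `r₀ ≤ 2` does not
   bound `t` below `3`; v1's `stub_fineSelmerCodimTwo : ∀ SWContext, r₀ ≤ 2 → SmallReducibleLocus` is therefore false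
   for `t ≥ 3` data.  v2's lever carries `ClosedPointStratumLE M.𝓡 3` (= `r₀ ≤ 2`, the pencil stratum) AND
   `AtMostTwoAlignedPlaces M` and the complement regime absorbs the rest.
3. THE SEED IS SURFACED.  The crux text says `[deps: EisensteinProModularSeed]`; v1 buried the route's rank-3 crux
   inside S3's intended proof.  v2 takes `EisensteinProModularSeed` (item stmt-Langlands-12920, a registered
   obligation of the route) as the FIRST hypothesis of the composition BY NAME and invokes it FIRST, so that the
   model is built at level `S♯ ∪ {q}` containing the seed's auxiliary place `q` (Skinner–Wiles' `𝒟 = (𝒪, Σ, c, ℳ)`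
   with `ℳ = {q}` folded into `Σ`) — hence the sorry-free-but-for-stubs closed theorem of this file is
   `proModularOfEisensteinSeed_proof : ProModularOfEisensteinSeed` (item stmt-Langlands-14718, seed ⇒ engine) and
   the crux follows by the landed glue `Theorems.reducibleOrdinaryProModular_of_seed` once 12920 closes —, and
   S3 ∪ S4 are re-cut along Skinner–Wiles' own seams into
   (P2) `stub_seedPatchingPrime` (the seed's point gives a patching prime of `R_𝒟`: entrance + SW Prop. 4.2 transport),
   (X2) `stub_presentationBound` (every component of `Spec R_𝒟` has dimension `≥ 4 = dim Λ_F − l₀`),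
   (conn) `stub_raynaudConnectivity` (Raynaud at margin one: two components of different classes meet at a big
   prime — `dim ≥ 3`, irreducible, ratios of infinite order), (supply) `stub_patchingPrimeSupply` (commutative
   algebra: a dimension-one prime above a big prime keeping irreducibility and infinite order — countable prime
   avoidance; the second use of (G), triage X1, is thereby moved INTO the bigness clause that (conn) must deliver),
   (P1) `stub_descentFromPatchingPrime` (defect-one patching at a patching prime: THE shared open core of every line,
   in its cleanest base-level form), composed by the LANDED abstract propagation theorem `proMod_of_propagation`
   ([SW, Prop. 4.1]) and the LANDED exit.  The composition minus `stub_eisensteinSeed` is exactly the content of item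
   stmt-Langlands-14718 (`ProModularOfEisensteinSeed`).

Registered stubs of v8 (6, `sorry` only there): S2 `stub_fineSelmerCodimTwo`, P2' `stub_seedResidualTransport`, X2⁰ `stub_nearlyOrdinaryPresentation`, B `stub_crossingsAreBig`, P1 `stub_descentFromPatchingPrime`, S5 `stub_largeResidualRank` — P2, X2, (R) are PROVED (p120508 ∘ P2', p119923 ∘ X2⁰, p122088); v4 list: `stub_fineSelmerCodimTwo` (S2, lever, HARDEST of the line),
`stub_seedPatchingPrime` (P2; realised sub-case LANDED p107008), `stub_cmPresentation` (X2, CM presentation; plumbing LANDED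
p109885), `stub_raynaudConnectedness` ((R), pure commutative algebra, theorem in print; chain/crossing reductions LANDED
p110592), `stub_crossingsAreBig` ((B), the margin-one bet), `stub_descentFromPatchingPrime` (P1, core; reductions LANDED
p112064), `stub_largeResidualRank` (S5, complement regime, not staffed); `stub_patchingPrimeSupply` (supply) LANDED p105384.
History: v2 (planner v1 re-typed; 7 stubs) → v2.1 (seed as hypothesis by name; X2 split off; infinite-order clause moved
into bigness) → v3 (vocabulary p97006 + supply p105384 landed) → v3.1 (X2 needs a place of the level away from `p`: with
`S = {v ∣ p}` and `χ̄₂ = ω̄χ̄₁` every count has margin zero — wave-2 finding; regime/S5 widened) → v4 (wave 3: the numerical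
"components ≥ 4" does not give connectedness in dimension 3; X2 now outputs the CM presentation, conn is split into
Raynaud's theorem (R) and the bet (B), composed by the LANDED `Theorems.conn_of_crossings`).  v2.1 (same day): v2's `stub_eisensteinSeed` dropped in
favour of the hypothesis-by-name form; X2 split off (conn); infinite-order clause moved from (supply)'s burden to the
bigness predicate (a twist family of an Artin point is a 3-dimensional irreducible closed set with finite-order ratio
everywhere — no patching prime above it —, so v2's supply was misstated).

Disproof used (`Cruxes/ReducibleOrdinaryProModular/Disproof.lean`, cdisprove v3, re-read 2026-08-16T10:20Z): no
`¬`-theorem, no `_false_without_<H>`, `## Targets` empty.  `crux_of_proModularity`: the method hypotheses are consumed by the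
landed S1 (orientation ⇒ `Models.oriented`, distinguishedness, integral model); `hunr` (NECESSARY, `withoutAEUnramified_iff`)
enters S1 (finiteness of `baseLevel ρ`) and the seed; level lemmas §§3,7: every level here is existential (`IsProModularPrime`
= ∃ 𝒰), never `TameLevel.full`.  Negatives index: one unrelated entry (stmt-Langlands-3797).
-/

set_option linter.dupNamespace false
set_option linter.unusedVariables false

/-! ## 0. Vocabulary: LANDED as `Theorems/SkinnerWilesDefectOneReducibleOrdinaryProModularFineSelmerDefs.lean` (p97006) and imported. -/

namespace Summit.Langlands.Langlands.Cruxes.ReducibleOrdinaryProModular.FineSelmerCodimensionTwo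

open scoped NumberField MatrixGroups
open Filter NumberField IsDedekindDomain Field Matrix
open Literature.NumberTheory.Automorphic Literature.NumberTheory.Automorphic.BigHeckeGLn
open Literature.NumberTheory.GaloisRepresentations
open Summit.Langlands.Langlands.Theses.SkinnerWilesDefectOne
open Summit.Langlands.Langlands.Cruxes.ReducibleOrdinaryProModular.SteinbergHyperplane

noncomputable section

/-! ## 1a. The statements of the stubs as NAMED `Prop`s (`S.*`; the hypotheses of `ReducibleOrdinaryProModular_of`
are these, BY NAME — the skeleton check refuses inline `∀`-hypotheses; the registered stubs of §1b restate them
verbatim and `*_iff := Iff.rfl` in §3 certifies the identity). -/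

/-- Statement of `stub_fineSelmerCodimTwo`. -/
def S.stub_fineSelmerCodimTwo : Prop :=
    ∀ (F : Type) [Field F] [NumberField F], IsTotallyComplex F → Module.finrank ℚ F = 2 →
      ∀ (p : ℕ) [Fact p.Prime], p ≠ 2 →
      ∀ M : ModelData F p, M.IsSWOriented p →
        ClosedPointStratumLE M.𝓡 3 → M.AtMostTwoAlignedPlaces p → SmallReducibleLocus M.𝓡

/-- Statement of `stub_seedPatchingPrime`. -/
def S.stub_seedPatchingPrime : Prop :=
    ∀ (F : Type) [Field F] [NumberField F], IsTotallyComplex F → Module.finrank ℚ F = 2 →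
      ∀ (p : ℕ) [Fact p.Prime], p ≠ 2 →
      ∀ (O : ValuationSubring (PadicAlgCl p)),
        O = (Valued.v : Valuation (PadicAlgCl p) NNReal).valuationSubring →
      ∀ (ρ : FramedGaloisRep F (PadicAlgCl p) 2) (ρ₀ : absoluteGaloisGroup F →* GL (Fin 2) O),
        ρ.toGaloisRep.IsIrreducible → (∀ᶠ v in cofinite, ρ.IsUnramifiedAt v) →
        ρ.HasUpperTriangularIntegralModel ρ₀ → OrdLoc p O ρ ρ₀ →
      ∀ (𝒰 : TameLevel 2 F p) (r : FramedGaloisRep F (PadicAlgCl p) 2)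
        (r₀ : absoluteGaloisGroup F →* GL (Fin 2) O) (q : HeightOneSpectrum (𝓞 F)), SeedData p ρ₀ 𝒰 r r₀ q →
      ∀ M : ModelData F p, M.Models ρ ρ₀ (baseLevel ρ ∪ {q}) → M.IsLocalPoint → SmallReducibleLocus M.𝓡 →
        ∃ 𝔭 : PrimeSpectrum M.𝓡.R, IsPatchingPrime M.𝓡 𝔭 ∧ IsProModularPrime M.𝓡 𝔭


/-- Statement of `stub_seedResidualTransport` (v6: the honest remainder of P2). -/
def S.stub_seedResidualTransport : Prop :=
    ∀ (F : Type) [Field F] [NumberField F], IsTotallyComplex F → Module.finrank ℚ F = 2 →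
      ∀ (p : ℕ) [Fact p.Prime], p ≠ 2 →
      ∀ (O : ValuationSubring (PadicAlgCl p)),
        O = (Valued.v : Valuation (PadicAlgCl p) NNReal).valuationSubring →
      ∀ (ρ : FramedGaloisRep F (PadicAlgCl p) 2) (ρ₀ : absoluteGaloisGroup F →* GL (Fin 2) O),
        ρ.toGaloisRep.IsIrreducible → (∀ᶠ v in cofinite, ρ.IsUnramifiedAt v) →
        ρ.HasUpperTriangularIntegralModel ρ₀ → OrdLoc p O ρ ρ₀ →
      ∀ (𝒰 : TameLevel 2 F p) (r : FramedGaloisRep F (PadicAlgCl p) 2)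
        (r₀ : absoluteGaloisGroup F →* GL (Fin 2) O) (q : HeightOneSpectrum (𝓞 F)), SeedData p ρ₀ 𝒰 r r₀ q →
      ∀ M : ModelData F p, M.Models ρ ρ₀ (baseLevel ρ ∪ {q}) → M.IsLocalPoint → SmallReducibleLocus M.𝓡 →
        ∃ (L : IntermediateField ℚ_[p] (PadicAlgCl p)) (_ : FiniteDimensional ℚ_[p] L)
            (ι : M.𝒪 →+* intermediateFieldIntegers p L)
            (κ : M.k →+* IsLocalRing.ResidueField (intermediateFieldIntegers p L))
            (_ : ∀ o, κ (algebraMap M.𝒪 M.k o) = IsLocalRing.residue (intermediateFieldIntegers p L) (ι o))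
            (rL : absoluteGaloisGroup F →* GL (Fin 2) (intermediateFieldIntegers p L)) (P : GL (Fin 2) (PadicAlgCl p)),
            (Matrix.GeneralLinearGroup.map (IsLocalRing.residue (intermediateFieldIntegers p L))).comp rL =
                (Matrix.GeneralLinearGroup.map κ).comp M.𝒟.residual ∧
            (∀ v : HeightOneSpectrum (𝓞 F), (p : 𝓞 F) ∈ v.asIdeal →
              ∃ PL : GL (Fin 2) (intermediateFieldIntegers p L),
                Matrix.GeneralLinearGroup.map (IsLocalRing.residue (intermediateFieldIntegers p L)) PL =
                  Matrix.GeneralLinearGroup.map κ (M.𝒟.frame v) ∧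
                ∀ σ, (PL⁻¹ * rL (absGaloisRestrict F (v.adicCompletion F) σ) * PL).val 1 0 = 0) ∧
            ∀ g, Matrix.GeneralLinearGroup.map
              ((algebraMap L (PadicAlgCl p)).comp (intermediateFieldIntegers p L).subtype) (rL g) = P⁻¹ * r g * P

/-- Statement of `stub_nearlyOrdinaryPresentation` (v7/v8: the Literature debt behind X2). -/
def S.stub_nearlyOrdinaryPresentation : Prop :=
  Literature.NumberTheory.GaloisRepresentations.NearlyOrdinaryPresentation

/-- Statement of `stub_cmPresentation`. -/
def S.stub_cmPresentation : Prop :=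
    ∀ (F : Type) [Field F] [NumberField F], IsTotallyComplex F → Module.finrank ℚ F = 2 →
      ∀ (p : ℕ) [Fact p.Prime], p ≠ 2 →
      ∀ M : ModelData F p, M.IsSWOriented p →
        (∀ X : Matrix (Fin 2) (Fin 2) M.k, (∀ g : absoluteGaloisGroup F,
          (ZMod.castHom (dvd_refl p) M.k (PadicInt.toZMod ((GaloisRep.cyclotomicCharacter F p g : ℤ_[p]ˣ) : ℤ_[p]))) •
            ((M.𝒟.residual g).val * X) = X * (M.𝒟.residual g).val) → X = 0) →
        (∃ (A : Type) (_ : CommRing A) (_ : IsNoetherianRing A) (_ : IsLocalRing A)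
            (_ : IsAdicComplete (IsLocalRing.maximalIdeal A) A) (rs : List A) (I : Ideal A) (_ : M.𝓡.R ≃+* A ⧸ I),
            (∀ r ∈ rs, r ∈ IsLocalRing.maximalIdeal A) ∧ RingTheory.Sequence.IsRegular A rs ∧
              (rs.length : WithBot ℕ∞) = ringKrullDim A ∧ ((4 : ℕ) : WithBot ℕ∞) + I.spanFinrank ≤ ringKrullDim A)

/-- Statement of `stub_raynaudConnectedness`. -/
def S.stub_raynaudConnectedness : Prop :=
    ∀ (R : Type) [CommRing R] (A : Type) [CommRing A] [IsNoetherianRing A] [IsLocalRing A]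
      [IsAdicComplete (IsLocalRing.maximalIdeal A) A] (rs : List A),
      (∀ r ∈ rs, r ∈ IsLocalRing.maximalIdeal A) → RingTheory.Sequence.IsRegular A rs →
      (rs.length : WithBot ℕ∞) = ringKrullDim A →
      ∀ (I : Ideal A) (_ : R ≃+* A ⧸ I) (n : ℕ), ((n + 1 : ℕ) : WithBot ℕ∞) + I.spanFinrank ≤ ringKrullDim A →
      ∀ S : Set (PrimeSpectrum R),
        (∃ C ∈ S, C.asIdeal ∈ minimalPrimes R) → (∃ C ∉ S, C.asIdeal ∈ minimalPrimes R) →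
          ∃ C₁ ∈ S, ∃ C₂ ∉ S, C₁.asIdeal ∈ minimalPrimes R ∧ C₂.asIdeal ∈ minimalPrimes R ∧
            (n : WithBot ℕ∞) ≤ ringKrullDim (R ⧸ (C₁.asIdeal ⊔ C₂.asIdeal))

/-- Statement of `stub_crossingsAreBig`. -/
def S.stub_crossingsAreBig : Prop :=
    ∀ (F : Type) [Field F] [NumberField F], IsTotallyComplex F → Module.finrank ℚ F = 2 →
      ∀ (p : ℕ) [Fact p.Prime], p ≠ 2 →
      ∀ M : ModelData F p, M.IsSWOriented p → SmallReducibleLocus M.𝓡 →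
        (∃ (A : Type) (_ : CommRing A) (_ : IsNoetherianRing A) (_ : IsLocalRing A)
            (_ : IsAdicComplete (IsLocalRing.maximalIdeal A) A) (rs : List A) (I : Ideal A) (_ : M.𝓡.R ≃+* A ⧸ I),
            (∀ r ∈ rs, r ∈ IsLocalRing.maximalIdeal A) ∧ RingTheory.Sequence.IsRegular A rs ∧
              (rs.length : WithBot ℕ∞) = ringKrullDim A ∧ ((4 : ℕ) : WithBot ℕ∞) + I.spanFinrank ≤ ringKrullDim A) →
        ∀ C₁ C₂ : PrimeSpectrum M.𝓡.R, C₁.asIdeal ∈ minimalPrimes M.𝓡.R → C₂.asIdeal ∈ minimalPrimes M.𝓡.R →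
          C₁ ≠ C₂ → ∀ Q : PrimeSpectrum M.𝓡.R, Q.asIdeal ∈ (C₁.asIdeal ⊔ C₂.asIdeal).minimalPrimes →
            ((3 : ℕ) : WithBot ℕ∞) ≤ ringKrullDim (M.𝓡.R ⧸ Q.asIdeal) →
              IsBigPrime M.𝓡 Q ∧
              (∀ (v : HeightOneSpectrum (𝓞 F)) (hv : (p : 𝓞 F) ∈ v.asIdeal),
              ¬ IsOfFinOrder ((Units.map (Ideal.Quotient.mk Q.asIdeal : M.𝓡.R →* M.𝓡.R ⧸ Q.asIdeal)).comp
                (M.𝓡.subChar v hv / M.𝓡.quotChar v hv)))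

/-- Statement of `stub_descentFromPatchingPrime`. -/
def S.stub_descentFromPatchingPrime : Prop :=
    ∀ (F : Type) [Field F] [NumberField F], IsTotallyComplex F → Module.finrank ℚ F = 2 →
      ∀ (p : ℕ) [Fact p.Prime], p ≠ 2 →
      ∀ M : ModelData F p, M.IsSWOriented p →
        ∀ 𝔭 : PrimeSpectrum M.𝓡.R, IsPatchingPrime M.𝓡 𝔭 → IsProModularPrime M.𝓡 𝔭 →
          ∀ 𝔮 : PrimeSpectrum M.𝓡.R, 𝔮 ≤ 𝔭 → IsProModularPrime M.𝓡 𝔮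

/-- Statement of `stub_largeResidualRank`. -/
def S.stub_largeResidualRank : Prop :=
    ∀ (F : Type) [Field F] [NumberField F], IsTotallyComplex F → Module.finrank ℚ F = 2 →
      ∀ (p : ℕ) [Fact p.Prime], p ≠ 2 →
      ∀ (O : ValuationSubring (PadicAlgCl p)),
        O = (Valued.v : Valuation (PadicAlgCl p) NNReal).valuationSubring →
      ∀ (ρ : FramedGaloisRep F (PadicAlgCl p) 2) (ρ₀ : absoluteGaloisGroup F →* GL (Fin 2) O),
        ρ.toGaloisRep.IsIrreducible → (∀ᶠ v in cofinite, ρ.IsUnramifiedAt v) →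
        ρ.HasUpperTriangularIntegralModel ρ₀ → OrdLoc p O ρ ρ₀ →
      ∀ (q : HeightOneSpectrum (𝓞 F)) (M : ModelData F p), M.Models ρ ρ₀ (baseLevel ρ ∪ {q}) → M.IsLocalPoint →
        ¬ (ClosedPointStratumLE M.𝓡 3 ∧ M.AtMostTwoAlignedPlaces p ∧
          (∀ X : Matrix (Fin 2) (Fin 2) M.k, (∀ g : absoluteGaloisGroup F,
          (ZMod.castHom (dvd_refl p) M.k (PadicInt.toZMod ((GaloisRep.cyclotomicCharacter F p g : ℤ_[p]ˣ) : ℤ_[p]))) •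
            ((M.𝒟.residual g).val * X) = X * (M.𝒟.residual g).val) → X = 0)) → ProMod p ρ

/-! ## 1b. The stubs of v2 (registered; `sorry` only here).  S1 is the LANDED `stub_orientedLocalDatum`. -/

/-- **Stub S2 `stub_fineSelmerCodimTwo` — THE LEVER, corrected (size XL; Galois/Iwasawa side only; HARDEST of the
line).**  For an SW-oriented model over an imaginary quadratic `F`, `p` odd, in the regime
`ClosedPointStratumLE M.𝓡 3` (the residual pencil stratum `K_p` has dimension `r₀ + 1 ≤ 3`, i.e. `r₀ ≤ 2`) and
`AtMostTwoAlignedPlaces` (`t ≤ 2`: the fixed-point stratum `Ψ⁺ = ν̃ε` has dimension `t + 1 ≤ 3`), EVERY prime of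
the reducible locus has `dim R_𝒟/𝔮 ≤ 3` (`SmallReducibleLocus`).  Intended proof (card + triage r1-1 (F1)–(F7)):
(a) the dictionary — SW99 Lemma 2.7's universal reducible deformation transposed to `F`: `R^red = B ⊗̂ Λ₂`,
`Λ₂ = 𝒪⟦T₁,T₂⟧` (twists of `Ψ₂`), `B` a chart of `ℙ(H)` over `Λ₁ = 𝒪⟦Gal(F̃_∞/F)⟧ ≅ 𝒪⟦Y₁,Y₂⟧`, `H` the
`p`-SPLIT fine Selmer module of the universal ratio `Ψ` (type-`𝒟` reducible deformations are split at `v ∣ p`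
because the n.o. line is residually transverse), so `dim R/𝔮 = 2 + dim Z + (r_Z − 1)` on the stratum `Z ⊆ Spec Λ₁`
of `𝔮`; (b) the strata: closed point — hypothesis; height-two (`𝒪'`-points `Ψ₀`): `r(Ψ₀) = rank H¹_split(G_S, Ψ₀)
≤ e(Ψ₀) − 1 +` (localisation defect), `e(Ψ₀)` = number of tame Euler divisors `{Ψ(Frob_v) = N v}` through `Ψ₀`,
`≤ t ≤ 2` (all of them pass through `Ψ⁺`; this is where `AtMostTwoAlignedPlaces` is spent), so dimension
`2 + 0 + r − 1 ≤ 3` once the localisation defect (a dual fine Selmer group) vanishes generically — Greenberg–Wiles /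
Poitou–Tate; height-one and `μ`: ABSENT — `H` is `Λ₁`-torsion by weak Leopoldt (`rank H¹_Iw = r₂(F) = 1 < 2`) and
has no height-one support by Rubin's two-variable main conjecture (split `p`: `Supp ⊆ V(L_𝔭) ∩ V(L_𝔭̄)`, primitive
common divisors excluded GGC-style, `μ = 0` by Gillard/Hida for split `p ≥ 5`); inert/ramified `p`: pseudo-nullity
of `H` is a bare bet (the route's witness has `5` inert).  Why it might fail: a primitive common divisor of the Katz
pair seen by `H`; a non-cyclic height-two stalk; `μ ≠ 0` for inert `p`; `p = 3`, `F = ℚ(√−3)`.  NOT in the tree: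
the Lemma 2.7 dictionary, `Λ₁`-adic Selmer modules, Rubin 1991 — expect `stub-blocked` on those named facts.
Sources: SkinnerWiles1999 Lemmas 2.5–2.9; Rubin, Invent. 103 (1991); arXiv:1512.00273 §1.2; Gillard 1985;
CalegariMazur2008 §1; lead gen 0 evidence `line-steinberg-hyperplane-S3-misstated.md` (the `t + 1` count). -/
theorem stub_fineSelmerCodimTwo :
    ∀ (F : Type) [Field F] [NumberField F], IsTotallyComplex F → Module.finrank ℚ F = 2 →
      ∀ (p : ℕ) [Fact p.Prime], p ≠ 2 →
      ∀ M : ModelData F p, M.IsSWOriented p →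
        ClosedPointStratumLE M.𝓡 3 → M.AtMostTwoAlignedPlaces p → SmallReducibleLocus M.𝓡 := by
  sorry

/-- **Stub P2' `stub_seedResidualTransport` — RESIDUAL TRANSPORT of the seed (v6 split of P2 after wave-1 worker P2's
`stub-misstated`; size XL; the honest remainder of Skinner–Wiles (II)).**  For the crux data and the seed's pro-modular point `r`
(`SeedData`), and a model `M` of `(ρ, ρ₀)` at level `S♯ ∪ {q}` with a local integral specialisation and small reducible locus:
`r` has an `𝒪_L`-lattice (`L/ℚ_p` finite, `ι : M.𝒪 → 𝒪_L`, `κ : M.k → k_L` compatible) whose reduction IS `κ ∘ ρ̄_𝒟` (same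
residual EXTENSION CLASS, not only the same diagonal) and which is upper triangular at `v ∣ p` in a lift of THE residual frame
`M.𝒟.frame v` — i.e. `r` is a type-`M.𝒟` point.  Given this, P2 is PROVED (`stub_seedPatchingPrime_auxOfLattice`, p120508:
automatic integrality, universality, entrance, irreducibility, infinite-order ratio).  Intended proof = [SW99, Prop. 4.2 / §4.4]
transport of the residual type through the reducible locus (uses (P1) on companion data) or, in the unique-admissible-class
sub-regime, Berger–Klosin residual uniqueness + coefficient descent; why it might fail: exactly P2's former (ii); not in print at
`l₀ = 1`.  Sources: SkinnerWiles1999 §4.4 Prop. 4.2; BergerKlosin2012 Lemma 28; worker report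
`work/stubs/stub_seedPatchingPrime-REPORT.md` (c3 wave 1). -/
theorem stub_seedResidualTransport :
    ∀ (F : Type) [Field F] [NumberField F], IsTotallyComplex F → Module.finrank ℚ F = 2 →
      ∀ (p : ℕ) [Fact p.Prime], p ≠ 2 →
      ∀ (O : ValuationSubring (PadicAlgCl p)),
        O = (Valued.v : Valuation (PadicAlgCl p) NNReal).valuationSubring →
      ∀ (ρ : FramedGaloisRep F (PadicAlgCl p) 2) (ρ₀ : absoluteGaloisGroup F →* GL (Fin 2) O),
        ρ.toGaloisRep.IsIrreducible → (∀ᶠ v in cofinite, ρ.IsUnramifiedAt v) →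
        ρ.HasUpperTriangularIntegralModel ρ₀ → OrdLoc p O ρ ρ₀ →
      ∀ (𝒰 : TameLevel 2 F p) (r : FramedGaloisRep F (PadicAlgCl p) 2)
        (r₀ : absoluteGaloisGroup F →* GL (Fin 2) O) (q : HeightOneSpectrum (𝓞 F)), SeedData p ρ₀ 𝒰 r r₀ q →
      ∀ M : ModelData F p, M.Models ρ ρ₀ (baseLevel ρ ∪ {q}) → M.IsLocalPoint → SmallReducibleLocus M.𝓡 →
        ∃ (L : IntermediateField ℚ_[p] (PadicAlgCl p)) (_ : FiniteDimensional ℚ_[p] L)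
            (ι : M.𝒪 →+* intermediateFieldIntegers p L)
            (κ : M.k →+* IsLocalRing.ResidueField (intermediateFieldIntegers p L))
            (_ : ∀ o, κ (algebraMap M.𝒪 M.k o) = IsLocalRing.residue (intermediateFieldIntegers p L) (ι o))
            (rL : absoluteGaloisGroup F →* GL (Fin 2) (intermediateFieldIntegers p L)) (P : GL (Fin 2) (PadicAlgCl p)),
            (Matrix.GeneralLinearGroup.map (IsLocalRing.residue (intermediateFieldIntegers p L))).comp rL =
                (Matrix.GeneralLinearGroup.map κ).comp M.𝒟.residual ∧
            (∀ v : HeightOneSpectrum (𝓞 F), (p : 𝓞 F) ∈ v.asIdeal →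
              ∃ PL : GL (Fin 2) (intermediateFieldIntegers p L),
                Matrix.GeneralLinearGroup.map (IsLocalRing.residue (intermediateFieldIntegers p L)) PL =
                  Matrix.GeneralLinearGroup.map κ (M.𝒟.frame v) ∧
                ∀ σ, (PL⁻¹ * rL (absGaloisRestrict F (v.adicCompletion F) σ) * PL).val 1 0 = 0) ∧
            ∀ g, Matrix.GeneralLinearGroup.map
              ((algebraMap L (PadicAlgCl p)).comp (intermediateFieldIntegers p L).subtype) (rL g) = P⁻¹ * r g * P := by
  sorry

/-- **P2 `stub_seedPatchingPrime` — the seed's point is a pro-modular PATCHING prime of `R_𝒟` — PROVED (v6) from the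
residual-transport stub `stub_seedResidualTransport` by the LANDED `stub_seedPatchingPrime_auxOfLattice` (p120508); formerly:
size L in the unique-class sub-regime, XL in general; Skinner–Wiles (II) + Prop. 4.2.**  For the crux data
`(ρ, ρ₀)`, the seed's output `(𝒰, r, r₀, q)` (`SeedData`), and a model `M` of `(ρ, ρ₀)` at level `S♯ ∪ {q}` with a
local integral specialisation and small reducible locus: `R_𝒟` has a prime `𝔭` which is a patching prime
(dimension one, irreducible, ratio `ψ₁⁽ᵛ⁾/ψ₂⁽ᵛ⁾` on `D_v` of infinite order at every `v ∣ p`) AND pro-modular at some tame level.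
Intended proof: `r` is unramified outside `{v ∣ p} ∪ Ram(χ̄₁, χ̄₂) ∪ {q} ⊆ S♯ ∪ {q} = M.𝒟.S` (level control of the
seed + `bad ⊇ Ram r`, Disproof §2); descend `r` to a finite `L/ℚ_p` (Baire), re-lattice (Ribet, both directions) to a
NON-SPLIT reduction with sub `χ̄₁` — the orientation of `r` survives because `r`'s ordinary line reduces to the
`χ̄₂`-line —; (i) if the resulting residual extension class is that of `M.𝒟` (automatic when the admissible class
is unique, `r₀ = 1`: Berger–Klosin residual uniqueness; kit j008702: `b₃ = 1` for the 11a witness over five fields)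
AND `k_L = M.k`, universality gives `φ_r : R_𝒟 → 𝒪_L` realising `r`, `ker φ_r` is pro-modular by the LANDED
entrance `isProModularPrimeAt_ker_of_isPadicallyAutomorphic_intermediateFieldIntegers`, irreducible by the LANDED
`ker_notMem_reducibleLocus`, of dimension one (`R/ker φ_r ⊆ 𝒪_L` integral over `𝒪`), with inertial ratio
`ε^{±(k'−1)m}·finite` of infinite order from `r`'s ordinary clause; (ii) otherwise TRANSPORT of the class (SW99
Prop. 4.2/§4.4: pass through the reducible locus using the Lemma 2.7 dictionary — this uses (P1) on the companion
datum `𝒟_{c'}`) and, for `k_L ⊋ M.k`, base change of the coefficient ring (`R_𝒟 ⊗_𝒪 𝒪_L` represents the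
base-changed functor — NOT exposed by the tree's interface `NearlyOrdinaryDeformationRing`, whose test rings have
residue field exactly `k`: a vocabulary gap to be filed).  Why it might fail: only (ii)'s size; the statement is
implied by big `R = 𝕋`.  Sources: SkinnerWiles1999 §4.1, §4.4 Prop. 4.2; Mazur1997Deformation §20; BergerKlosin2012
Lemma 28; the route file's `EisensteinProModularSeed` docstring. -/
theorem stub_seedPatchingPrime :
    ∀ (F : Type) [Field F] [NumberField F], IsTotallyComplex F → Module.finrank ℚ F = 2 →
      ∀ (p : ℕ) [Fact p.Prime], p ≠ 2 →
      ∀ (O : ValuationSubring (PadicAlgCl p)),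
        O = (Valued.v : Valuation (PadicAlgCl p) NNReal).valuationSubring →
      ∀ (ρ : FramedGaloisRep F (PadicAlgCl p) 2) (ρ₀ : absoluteGaloisGroup F →* GL (Fin 2) O),
        ρ.toGaloisRep.IsIrreducible → (∀ᶠ v in cofinite, ρ.IsUnramifiedAt v) →
        ρ.HasUpperTriangularIntegralModel ρ₀ → OrdLoc p O ρ ρ₀ →
      ∀ (𝒰 : TameLevel 2 F p) (r : FramedGaloisRep F (PadicAlgCl p) 2)
        (r₀ : absoluteGaloisGroup F →* GL (Fin 2) O) (q : HeightOneSpectrum (𝓞 F)), SeedData p ρ₀ 𝒰 r r₀ q →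
      ∀ M : ModelData F p, M.Models ρ ρ₀ (baseLevel ρ ∪ {q}) → M.IsLocalPoint → SmallReducibleLocus M.𝓡 →
        ∃ 𝔭 : PrimeSpectrum M.𝓡.R, IsPatchingPrime M.𝓡 𝔭 ∧ IsProModularPrime M.𝓡 𝔭 :=
  fun F _ _ hF hdeg p _ hp O hO ρ ρ₀ hirr hunr hmod hloc 𝒰 r r₀ q hseed M hM hMloc hsmall =>
    stub_seedPatchingPrime_auxOfLattice F hF hdeg p hp O hO ρ ρ₀ hirr hunr hmod hloc 𝒰 r r₀ q hseed M hM hMloc hsmall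
      (stub_seedResidualTransport F hF hdeg p hp O hO ρ ρ₀ hirr hunr hmod hloc 𝒰 r r₀ q hseed M hM hMloc hsmall)

/-- **Stub X2⁰ `stub_nearlyOrdinaryPresentation` — the LITERATURE DEBT behind X2 (v7).**  Böckle's presentation theorem
for the universal nearly ordinary deformation ring with unfixed determinant [Böckle 2007, *Presentations of universal
deformation rings*, LMS LNS 320, Thm 7.6], vendored by wave-1 worker X2 as the named fact
`Literature.NumberTheory.GaloisRepresentations.NearlyOrdinaryPresentation` (p119922, a `def : Prop` with its own debt item):
`R_𝒟 ≅ 𝒪⟦x₁,…,x_{h¹}⟧/(f₁,…,f_{h²})` with `h¹ − h² = [F:ℚ]·2 + 1 − h⁰(G_F, ad ρ̄ ⊗ ω̄)` in the tree's dialect.  X2 is PROVED from it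
(`stub_cmPresentation_of_presentation`, p119923).  Why it might fail: it is a published theorem; the formal debt is Galois
cohomology (Poitou–Tate / Greenberg–Wiles) which the tree does not have.  Sources: Böckle 2007 Thm 7.6; Kisin, Ann. Math. 170 §3. -/
theorem stub_nearlyOrdinaryPresentation : Literature.NumberTheory.GaloisRepresentations.NearlyOrdinaryPresentation := by
  sorry

/-- **Stub X2 `stub_cmPresentation` — the COHEN–MACAULAY PRESENTATION of `R_𝒟` at margin one (size L/XL;
Galois cohomology + local deformation rings; triage r1-2 X2; v4 reshape of v2's `stub_presentationBound` after waves 2–3).**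
For an SW-oriented model over an imaginary quadratic `F`, `p` odd, with `H⁰(G_F, ad ρ̄_𝒟 ⊗ ω̄) = 0` (v5 reshape
2026-08-16 after wave-1 worker X2: Böckle 2007 Thm 7.6 carries `−h⁰(G_F, ad ρ̄ ⊗ ω̄)` WHATEVER THE LEVEL, his Rem. 5.4, so the
v3.1 level clause `∃ v ∈ S, v ∤ p` does not give margin one; the fact is landed as
`Literature.NumberTheory.GaloisRepresentations.NearlyOrdinaryPresentation`, p119922, and X2 follows from it by
`stub_cmPresentation_of_presentation`, p119923): `R_𝒟 ≅ A ⧸ I` with `A` a complete Noetherian local ring having an `A`-regular sequence in `𝔪_A` of length `dim A`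
(Cohen–Macaulay) and `4 + μ(I) ≤ dim A` (`μ = Ideal.spanFinrank`).  This is EXACTLY the input of Raynaud's theorem
(`stub_raynaudConnectedness`) and of the margin-one bet (`stub_crossingsAreBig`); its numerical shadow "every component
has `dim ≥ 4`" is the LANDED `stub_presentationBound_auxKrull` (p109885).  Intended proof (wave-2 report
`work/stubs/stub_presentationBound-REPORT.md` §2): (P) Böckle's relative presentation `R_𝒟^□ ≅ B⟦x₁,…,x_g⟧/(f₁,…,f_b)`,
`B = ⊗̂_{v∣p} R_v^{Bor,□}` the framed Borel (nearly-ordinary, residual line prescribed) lifting rings, `g − b ≥ h¹ − h²`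
of the cone of `C•(G_{F,S}, ad ρ̄) → ⊕_{v∣p} C•(G_v, ad ρ̄)`, `= 4 − 8 + 0 − h³`, `h³ = [S = {v∣p}]·h⁰(G_S, ad ρ̄(1))`
(killed by the level hypothesis: global invariants restrict injectively to any local ones); (CM) Snowden,
*Singularities of ordinary deformation rings*, Math. Z. 288 (2018) = arXiv:1111.3654: `R_v^{Bor,□}` is `𝒪`-flat
Cohen–Macaulay of dimension `1 + 4 + 3[F_v:ℚ_p]`, including the obstructed cases `χ̄₂/χ̄₁|_{G_v} = ω^{±1}`;
unframing (scalar centralizer) and the LANDED transport between instances of the interface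
(`stub_presentationBound_auxUnique/_auxTransport`, p109885).  Why it might fail: only if (CM) fails for
`[F_v:ℚ_p] = 2`.  NOT in the tree: local lifting rings, completed tensor products of CNL algebras, any
Euler–Poincaré / Poitou–Tate formula — `stub-blocked` on (P)+(CM) as the named fact
`nearlyOrdinaryDeformationRing_presentation` (report §2, exact signature there).  Sources: Böckle, *Presentations of
universal deformation rings* (LMS LNS 320, 2007); Kisin, Ann. Math. 170 (2009) §3; arXiv:1111.3654; SkinnerWiles1999
Prop. 2.4; CalegariMazur2008 §1. -/
theorem stub_cmPresentation :
    ∀ (F : Type) [Field F] [NumberField F], IsTotallyComplex F → Module.finrank ℚ F = 2 →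
      ∀ (p : ℕ) [Fact p.Prime], p ≠ 2 →
      ∀ M : ModelData F p, M.IsSWOriented p →
        (∀ X : Matrix (Fin 2) (Fin 2) M.k, (∀ g : absoluteGaloisGroup F,
          (ZMod.castHom (dvd_refl p) M.k (PadicInt.toZMod ((GaloisRep.cyclotomicCharacter F p g : ℤ_[p]ˣ) : ℤ_[p]))) •
            ((M.𝒟.residual g).val * X) = X * (M.𝒟.residual g).val) → X = 0) →
        (∃ (A : Type) (_ : CommRing A) (_ : IsNoetherianRing A) (_ : IsLocalRing A)
            (_ : IsAdicComplete (IsLocalRing.maximalIdeal A) A) (rs : List A) (I : Ideal A) (_ : M.𝓡.R ≃+* A ⧸ I),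
            (∀ r ∈ rs, r ∈ IsLocalRing.maximalIdeal A) ∧ RingTheory.Sequence.IsRegular A rs ∧
              (rs.length : WithBot ℕ∞) = ringKrullDim A ∧ ((4 : ℕ) : WithBot ℕ∞) + I.spanFinrank ≤ ringKrullDim A) :=
  stub_cmPresentation_of_presentation stub_nearlyOrdinaryPresentation

/- **(R) `stub_raynaudConnectedness` — LANDED (c3): `…Theorems/SkinnerWilesDefectOneReducibleOrdinaryProModularRaynaudConnectedness.lean`,
Grothendieck SGA 2 XIII 2.1 PROVED in the tree (`Theorems.GrothendieckConnectedness_holds`) — imported, no longer a stub.**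
Original docstring: Stub (R) — Raynaud / Grothendieck connectedness in the crossing form of
[SW, Cor. A.2] (size L/XL; PURE COMMUTATIVE ALGEBRA, a theorem in print; v4 split of v2's `stub_raynaudConnectivity`).**
Let `A` be a complete Noetherian local ring with an `A`-regular sequence in `𝔪_A` of length `dim A` (Cohen–Macaulay),
`I` an ideal with `n + 1 + μ(I) ≤ dim A`, and `R ≅ A ⧸ I`.  Then `Spec R` is connected in dimension `n`: for every
two-colouring of the minimal primes of `R` using both colours, two minimal primes `C₁, C₂` of different colours have
`n ≤ dim R/(C₁ + C₂)`.  Intended proof: [SW, Prop. A.1] = Raynaud's Cor. 4.2 (the punctured spectrum of `A/I` is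
connected when `μ(I) ≤ dim A − 2`, `A` CM), then [SW, Cor. A.2] by induction on `dim A − μ(I)` via localisation at a
prime of the intersection; equivalently Grothendieck SGA2 XIII 2.1 in the form `c(A/𝔞) ≥ min(c(A), sdim A − 1) − ara(𝔞)`
(Brodmann–Sharp 19.2.12) with `c(A) ≥ dim A − 1` for CM `A` (Hartshorne 1962).  Why it might fail: nothing
mathematical; NOT in Mathlib or the tree (no depth / local cohomology / Hartshorne connectedness): `stub-blocked` on
vendoring it as a Literature fact (the wave-3 worker's `RaynaudConnectedness : Prop` elaborates, report
`work/stubs/stub_raynaudConnectivity-REPORT.md` §2).  Sources: SkinnerWiles1999 App. A (Prop. A.1, Cor. A.2);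
SGA2 Exp. XIII Thm 2.1; Brodmann–Sharp, *Local cohomology*, Ch. 19; Hartshorne, Amer. J. Math. 84 (1962). -/

/-- **Stub (B) `stub_crossingsAreBig` — THE MARGIN-ONE BET: generic points of 3-dimensional crossings are big
(size: open; the line's honest bet, isolated; v4 split of v2's `stub_raynaudConnectivity`).**  For an SW-oriented model
over an imaginary quadratic `F`, `p` odd, with small reducible locus and a Cohen–Macaulay presentation at margin one:
for distinct components `C₁ ≠ C₂` of `Spec R_𝒟` and a minimal prime `Q` of `C₁ + C₂` with `dim R/Q ≥ 3` (the generic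
point of a `≥ 3`-dimensional component `W` of the crossing), `Q ∉ Z^red` (B-red) and every ratio `ψ₁⁽ᵛ⁾/ψ₂⁽ᵛ⁾ mod Q`,
`v ∣ p`, has infinite order on `D_v` (B-ord).  Analysis (wave-3 report §§3–4, agreeing with the lead's): `W` is stable
under the 2-dimensional formal twisting group, hence (when `dim W = 3`) is the full twist family `{x ⊗ χ}` of any of its
one-dimensional points `x`; (B) fails at `W` iff `x` is reducible — then `W` is a reducible SHEET shared by `C₁, C₂`,
excluded when `(R_𝒟)_η` is a DVR at the sheet's generic point (card unibranch-eisenstein-sheets) — or `x` has a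
finite-order ratio at some `v ∣ p` (weight-one / Artin type at `v`; such crossings are typical over `ℚ`,
Dimitrov–Ghate).  So the bet reads: THE CROSSING GRAPH OF `Spec R_𝒟` STAYS CONNECTED THROUGH PATCHING-TYPE CROSSINGS —
Skinner–Wiles never meet it (margin two by base change); at `l₀ = 1` it is genuinely open and is where a disprover
should aim.  Sources: SkinnerWiles1999 §4.3; Dimitrov–Ghate (intersections of Hida families); card
unibranch-eisenstein-sheets; wave-3 report. -/
theorem stub_crossingsAreBig :
    ∀ (F : Type) [Field F] [NumberField F], IsTotallyComplex F → Module.finrank ℚ F = 2 →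
      ∀ (p : ℕ) [Fact p.Prime], p ≠ 2 →
      ∀ M : ModelData F p, M.IsSWOriented p → SmallReducibleLocus M.𝓡 →
        (∃ (A : Type) (_ : CommRing A) (_ : IsNoetherianRing A) (_ : IsLocalRing A)
            (_ : IsAdicComplete (IsLocalRing.maximalIdeal A) A) (rs : List A) (I : Ideal A) (_ : M.𝓡.R ≃+* A ⧸ I),
            (∀ r ∈ rs, r ∈ IsLocalRing.maximalIdeal A) ∧ RingTheory.Sequence.IsRegular A rs ∧
              (rs.length : WithBot ℕ∞) = ringKrullDim A ∧ ((4 : ℕ) : WithBot ℕ∞) + I.spanFinrank ≤ ringKrullDim A) →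
        ∀ C₁ C₂ : PrimeSpectrum M.𝓡.R, C₁.asIdeal ∈ minimalPrimes M.𝓡.R → C₂.asIdeal ∈ minimalPrimes M.𝓡.R →
          C₁ ≠ C₂ → ∀ Q : PrimeSpectrum M.𝓡.R, Q.asIdeal ∈ (C₁.asIdeal ⊔ C₂.asIdeal).minimalPrimes →
            ((3 : ℕ) : WithBot ℕ∞) ≤ ringKrullDim (M.𝓡.R ⧸ Q.asIdeal) →
              IsBigPrime M.𝓡 Q ∧
              (∀ (v : HeightOneSpectrum (𝓞 F)) (hv : (p : 𝓞 F) ∈ v.asIdeal),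
              ¬ IsOfFinOrder ((Units.map (Ideal.Quotient.mk Q.asIdeal : M.𝓡.R →* M.𝓡.R ⧸ Q.asIdeal)).comp
                (M.𝓡.subChar v hv / M.𝓡.quotChar v hv))) := by
  sorry

/-! (supply) `stub_patchingPrimeSupply` LANDED (p105384, `Theorems/SkinnerWilesDefectOneReducibleOrdinaryProModularPatchingPrimeSupply.lean`,
with countable prime avoidance in complete Noetherian local rings as `…PatchingPrimeSupplyAux.lean`, p102128) — imported and used BY NAME. -/

/-- **Stub P1 `stub_descentFromPatchingPrime` — DEFECT-ONE PATCHING: pro-modularity descends from a patching prime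
(size XL; THE shared open core of every line of this crux, here in its cleanest base-level form; the ROUTE'S BET —
`TaylorWilesNumericalCoincidence` at `l₀ = 1` met inside Calegari–Geraghty/Hansen two-term complexes).**  For an
SW-oriented model over an imaginary quadratic `F`, `p` odd: if `𝔭` is a patching prime of `R_𝒟` (dimension one,
`ρ_𝔭 = ρ_𝒟 mod 𝔭` irreducible, inertial ratios of infinite order at `v ∣ p`; characteristic `p` OR `0`) which is
pro-modular at some tame level, then EVERY prime `𝔮 ⊆ 𝔭` is pro-modular at some tame level — Skinner–Wiles' (P1)
"suppose `𝔭` is nice for `𝒟`; if `𝔮 ⊆ 𝔭` then `𝔮` is pro-modular" [SW, §4.2].  Intended proof: patch the two-term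
`P`-ordinary completed-homology complexes of the Bianchi tower in degrees `[q₀, q₀ + l₀] = [1, 2]`
(CalegariGeraghty2017 §§5, 8; Hansen2012; KhareThorne2017) LOCALISED AT `𝔭`, at a tame level deep enough at
`S ∖ {v ∣ p}` for the whole type-`𝒟` family (conductor exponents at `w ∤ p` are bounded along `R_𝒟`: Swan conductor
constant, tame part `≤ 2`) after moving `𝔭`'s pro-modularity to that level; Taylor–Wiles primes chosen relative to
the IRREDUCIBLE `ρ_𝔭` over `R/𝔭 ↪ k'⟦T⟧` resp. `𝒪'` (SW99 §§2.6, 3; big image from irreducible + infinite-order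
ratio; Mazur's condition needs no residual irreducibility), the deficit `l₀ = 1` absorbed by the complex; Hecke side:
Galois determinants on `𝕋(𝒰)_𝔪/J` (Scholze2015 Cor. V.4.3 — `F` is CM), Chenevier determinant-to-representation at
the irreducible `𝔭`, nearly-ordinary shape at `v ∣ p` from ordinary local–global compatibility (CaraianiNewton2023
Prop. 5.5.2 / Thm 4.2.15 — hypothesis (1) there EXCLUDES `F⁺ = ℚ`: the known door is a solvable CM ascent `F'/F` +
descent, card eisenstein-lgc-at-nice-prime; triage (C6)); non-minimal level at `S ∖ p` needs an Ihara-type input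
in Bianchi Hida families (SW99 §8; `PatchingLocalComponentBarrier`); output: every minimal prime of `(R_𝒟)_𝔭` is
pro-modular, hence every `𝔮 ⊆ 𝔭` (going up inside `V(𝔮_min)`, landed `IsProModularPrimeAt.of_le`).  Why it might
fail: everything in the crux's own why-might-fail — positive-defect patching relative to a dimension-one prime of a
`Λ_F`-TORSION family is unbuilt; no ordinary torsion LGC over imaginary quadratic `F`; Ihara.  Implied by big `R = 𝕋`
(GeeNewton2020 §3.3).  Sources: SkinnerWiles1999 §§2.6, 3, 4.2, 8; CalegariGeraghty2017 §§5, 8; Hansen2012;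
KhareThorne2017; Scholze2015 V.4; arXiv:2301.10509; arXiv:1812.09999 §6; GeeNewton2020;
`Literature.Barriers.Langlands.TaylorWilesNumericalCoincidence`, `…PatchingLocalComponentBarrier`. -/
theorem stub_descentFromPatchingPrime :
    ∀ (F : Type) [Field F] [NumberField F], IsTotallyComplex F → Module.finrank ℚ F = 2 →
      ∀ (p : ℕ) [Fact p.Prime], p ≠ 2 →
      ∀ M : ModelData F p, M.IsSWOriented p →
        ∀ 𝔭 : PrimeSpectrum M.𝓡.R, IsPatchingPrime M.𝓡 𝔭 → IsProModularPrime M.𝓡 𝔭 →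
          ∀ 𝔮 : PrimeSpectrum M.𝓡.R, 𝔮 ≤ 𝔭 → IsProModularPrime M.𝓡 𝔮 := by
  sorry

/-- **Stub S5 `stub_largeResidualRank` — the COMPLEMENT REGIME (v5: now also the data with `H⁰(G_F, ad ρ̄ ⊗ ω̄) ≠ 0`,
i.e. `χ̄₂ = ω̄χ̄₁` or `μ_p ⊂ F` — e.g. `ρ₀` from a rational `p`-torsion POINT —, where Böckle's presentation count has margin zero; HONEST LABEL: registered so that the composition
concludes the crux BY NAME for every `ρ`; NOT to be staffed from this line before the route planner rules on
restating the engine; size XL/open).**  For the crux data, the seed's `q`, and a model at level `S♯ ∪ {q}` with local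
integral specialisation which is OUTSIDE the lever's regime (`r₀ ≥ 3`, or `≥ 3` aligned places in `S♯ ∪ {q}` —
NOTE: the seed's `q`, if residually aligned (`Ψ̄(Frob_q) ≡ N q`, the level-RAISING sign), counts), `ρ` is still
`p`-adically automorphic.  Why plausibly true: big `R = 𝕋` / `ProModularityGL2` (Disproof §4).  Why no mechanism:
the pencil stratum `K_p` (`dim r₀ + 1 ≥ 4`) or the fixed-point stratum `Ψ⁺` (`dim t + 1 ≥ 4`) defeats
`SmallReducibleLocus`, Raynaud chains may stall inside them, and Skinner–Wiles' cure (cyclotomic base change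
shrinking `r₀` relative to `dim Λ`, Ferrero–Washington) is unavailable at `l₀ = 1`.  Recorded repairs (not this
line's): transversality of components to `K_p` (card, round 2); a TRANSVERSE choice of `q` (`Ψ̄(Frob_q) ≡ N q⁻¹`,
`N q² ≢ 1`) in the seed, which keeps `t` at its base-level value — a recommendation to the route planner for item
12920's statement.  Sources: SkinnerWiles1999 §4; CalegariGeraghty2017 Rem. 5.14; triage TRIAGE-r1-3.md (C5);
lead gen 0 evidence (`t`-count). -/
theorem stub_largeResidualRank :
    ∀ (F : Type) [Field F] [NumberField F], IsTotallyComplex F → Module.finrank ℚ F = 2 →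
      ∀ (p : ℕ) [Fact p.Prime], p ≠ 2 →
      ∀ (O : ValuationSubring (PadicAlgCl p)),
        O = (Valued.v : Valuation (PadicAlgCl p) NNReal).valuationSubring →
      ∀ (ρ : FramedGaloisRep F (PadicAlgCl p) 2) (ρ₀ : absoluteGaloisGroup F →* GL (Fin 2) O),
        ρ.toGaloisRep.IsIrreducible → (∀ᶠ v in cofinite, ρ.IsUnramifiedAt v) →
        ρ.HasUpperTriangularIntegralModel ρ₀ → OrdLoc p O ρ ρ₀ →
      ∀ (q : HeightOneSpectrum (𝓞 F)) (M : ModelData F p), M.Models ρ ρ₀ (baseLevel ρ ∪ {q}) → M.IsLocalPoint →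
        ¬ (ClosedPointStratumLE M.𝓡 3 ∧ M.AtMostTwoAlignedPlaces p ∧
          (∀ X : Matrix (Fin 2) (Fin 2) M.k, (∀ g : absoluteGaloisGroup F,
          (ZMod.castHom (dvd_refl p) M.k (PadicInt.toZMod ((GaloisRep.cyclotomicCharacter F p g : ℤ_[p]ˣ) : ℤ_[p]))) •
            ((M.𝒟.residual g).val * X) = X * (M.𝒟.residual g).val) → X = 0)) → ProMod p ρ := by
  sorry

/-! ## 2. The composition: landed S1 + landed propagation/exit + the stubs ⟹ crux BY NAME (no sorry of its own) -/

/-- **The line concludes the crux BY NAME (v2).**  Pure logic over the stub signatures and landed lemmas: the seed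
(S0) gives `(𝒰, r, r₀, q)`; the LANDED S1 `stub_orientedLocalDatum` gives an oriented model `M` of `(ρ, ρ₀)` at level
`S♯ ∪ {q}` with a local integral specialisation `φ`; case on the regime `ClosedPointStratumLE M.𝓡 3 ∧
AtMostTwoAlignedPlaces`: inside, the lever (S2) makes the reducible locus small, P2 turns the seed into a pro-modular
patching prime, and Skinner–Wiles' propagation [SW, Prop. 4.1] — the LANDED `Theorems.proMod_of_propagation` fed with
going-up (landed), (P1), (conn), (supply) — makes EVERY prime of `R_𝒟` pro-modular at some level, in particular
`ker φ`, whence `ProMod p ρ` by the LANDED exit `ModelData.Models.proMod_of_isProModularPrimeAt_le`; outside, S5. -/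
theorem ReducibleOrdinaryProModular_of (h₀ : EisensteinProModularSeed) (h₂ : S.stub_fineSelmerCodimTwo)
    (hP2 : S.stub_seedResidualTransport)
    (hX2 : S.stub_nearlyOrdinaryPresentation)
    (hB : S.stub_crossingsAreBig) (hP1 : S.stub_descentFromPatchingPrime) (h₅ : S.stub_largeResidualRank) :
    Summit.Langlands.Langlands.Theses.SkinnerWilesDefectOne.ReducibleOrdinaryProModular := by
  refine crux_iff.mpr ?_
  intro F _ _ hF hdeg p _ hp O hO ρ ρ₀ hirr hunr hmod hloc
  -- the seed (item 12920, hypothesis BY NAME) gives the auxiliary place `q` and the pro-modular point `r`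
  obtain ⟨𝒰s, r, r₀, q, hseed⟩ := (eisensteinProModularSeed_iff.mp h₀) F hF hdeg p hp O hO ρ ρ₀ hirr hunr hmod hloc
  -- S1 (LANDED): the oriented Skinner–Wiles model of `(ρ, ρ₀)` at level `S♯ ∪ {q}` with a local specialisation
  obtain ⟨M, hM, hMloc⟩ := stub_orientedLocalDatum F hF hdeg p hp O hO ρ ρ₀ hirr hunr hmod hloc q
  by_cases hreg : ClosedPointStratumLE M.𝓡 3 ∧ M.AtMostTwoAlignedPlaces p ∧
      (∀ X : Matrix (Fin 2) (Fin 2) M.k, (∀ g : absoluteGaloisGroup F,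
          (ZMod.castHom (dvd_refl p) M.k (PadicInt.toZMod ((GaloisRep.cyclotomicCharacter F p g : ℤ_[p]ˣ) : ℤ_[p]))) •
            ((M.𝒟.residual g).val * X) = X * (M.𝒟.residual g).val) → X = 0)
  · -- S2: the lever — small reducible locus
    have hsmall : SmallReducibleLocus M.𝓡 := h₂ F hF hdeg p hp M hM.isSWOriented hreg.1 hreg.2.1
    -- P2: the seed's point is a pro-modular patching prime (LANDED p120508, from the residual transport P2')
    have hseedPrime : ∃ 𝔭 : PrimeSpectrum M.𝓡.R, IsPatchingPrime M.𝓡 𝔭 ∧ IsProModularPrime M.𝓡 𝔭 :=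
      stub_seedPatchingPrime_auxOfLattice F hF hdeg p hp O hO ρ ρ₀ hirr hunr hmod hloc 𝒰s r r₀ q hseed M hM hMloc hsmall
        (hP2 F hF hdeg p hp O hO ρ ρ₀ hirr hunr hmod hloc 𝒰s r r₀ q hseed M hM hMloc hsmall)
    -- X2: the Cohen–Macaulay (in fact regular) presentation at margin one (`H⁰(G_F, ad ρ̄ ⊗ ω̄) = 0`, Böckle Thm 7.6)
    have hpres := stub_cmPresentation_of_presentation hX2 F hF hdeg p hp M hM.isSWOriented hreg.2.2
    -- conn = Raynaud's theorem (R) + the margin-one bet (B), composed by the LANDED `Theorems.conn_of_crossings`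
    have hconn : ∀ S : Set (PrimeSpectrum M.𝓡.R),
        (∃ C ∈ S, C.asIdeal ∈ minimalPrimes M.𝓡.R) → (∃ C ∉ S, C.asIdeal ∈ minimalPrimes M.𝓡.R) →
        ∃ C₁ ∈ S, ∃ C₂ ∉ S, C₁.asIdeal ∈ minimalPrimes M.𝓡.R ∧ C₂.asIdeal ∈ minimalPrimes M.𝓡.R ∧
          ∃ Q : PrimeSpectrum M.𝓡.R, C₁ ≤ Q ∧ C₂ ≤ Q ∧ (IsBigPrime M.𝓡 Q ∧
            ∀ (v : HeightOneSpectrum (𝓞 F)) (hv : (p : 𝓞 F) ∈ v.asIdeal),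
              ¬ IsOfFinOrder ((Units.map (Ideal.Quotient.mk Q.asIdeal : M.𝓡.R →* M.𝓡.R ⧸ Q.asIdeal)).comp
                (M.𝓡.subChar v hv / M.𝓡.quotChar v hv))) := by
      obtain ⟨A, iA, iN, iL, iC, rs, I, e, hmem, hregA, hdimA, h4⟩ := hpres
      exact Summit.Langlands.Langlands.Theorems.conn_of_crossings _ 3
        (stub_raynaudConnectedness M.𝓡.R A rs hmem hregA hdimA I e 3 h4)
        (hB F hF hdeg p hp M hM.isSWOriented hsmall ⟨A, iA, iN, iL, iC, rs, I, e, hmem, hregA, hdimA, h4⟩)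
    -- [SW, Prop. 4.1] (LANDED abstract propagation): every prime of `R_𝒟` is pro-modular at some level
    have hall : ∀ 𝔮 : PrimeSpectrum M.𝓡.R, IsProModularPrime M.𝓡 𝔮 :=
      Summit.Langlands.Langlands.Theorems.proMod_of_propagation
        (IsProModularPrime M.𝓡) (IsPatchingPrime M.𝓡)
        (fun Q => IsBigPrime M.𝓡 Q ∧
          ∀ (v : HeightOneSpectrum (𝓞 F)) (hv : (p : 𝓞 F) ∈ v.asIdeal),
            ¬ IsOfFinOrder ((Units.map (Ideal.Quotient.mk Q.asIdeal : M.𝓡.R →* M.𝓡.R ⧸ Q.asIdeal)).comp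
              (M.𝓡.subChar v hv / M.𝓡.quotChar v hv)))
        (fun 𝔮 𝔭 hle h𝔮 => IsProModularPrime.of_le M.𝓡 hle h𝔮)
        (fun 𝔭 h𝔭 h𝔭' 𝔮 hle => hP1 F hF hdeg p hp M hM.isSWOriented 𝔭 h𝔭 h𝔭' 𝔮 hle)
        hseedPrime
        hconn
        (fun Q hQ => stub_patchingPrimeSupply F hF hdeg p hp M hM.isSWOriented Q hQ.1 hQ.2)
    -- in particular `ker φ`; EXIT (LANDED)
    obtain ⟨𝒰, h𝒰⟩ := hall ⟨RingHom.ker M.φ, RingHom.ker_isPrime M.φ⟩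
    exact hM.proMod_of_isProModularPrimeAt_le hMloc le_rfl h𝒰
  · -- outside the regime: S5
    exact h₅ F hF hdeg p hp O hO ρ ρ₀ hirr hunr hmod hloc q M hM hMloc hreg

/-- **Item stmt-Langlands-14718 `ProModularOfEisensteinSeed` (seed ⇒ engine) from the landed S1 and the seven
registered stubs of v4** (the only sorries are inside `stub_*`): the closed theorem of this skeleton.  The crux
itself then follows from item stmt-Langlands-12920 by the landed glue
`Summit.Langlands.Langlands.Theorems.reducibleOrdinaryProModular_of_seed`. -/
theorem proModularOfEisensteinSeed_proof : ProModularOfEisensteinSeed := fun h₀ =>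
  ReducibleOrdinaryProModular_of h₀ stub_fineSelmerCodimTwo stub_seedResidualTransport stub_nearlyOrdinaryPresentation
    stub_crossingsAreBig stub_descentFromPatchingPrime stub_largeResidualRank

/-- `S.stub_nearlyOrdinaryPresentation` is the named Literature fact. -/
theorem stub_nearlyOrdinaryPresentation_iff : S.stub_nearlyOrdinaryPresentation ↔
    Literature.NumberTheory.GaloisRepresentations.NearlyOrdinaryPresentation := Iff.rfl

/-- The crux from the seed (item 12920, hypothesis) and the stubs — the shape the gate's skeleton audit reads. -/
theorem ReducibleOrdinaryProModular_proof (h₀ : EisensteinProModularSeed) :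
    Summit.Langlands.Langlands.Theses.SkinnerWilesDefectOne.ReducibleOrdinaryProModular :=
  proModularOfEisensteinSeed_proof h₀

/-! ## 3. Certificates: each registered stub's statement IS the named `Prop` (definitional) -/

theorem stub_fineSelmerCodimTwo_iff : S.stub_fineSelmerCodimTwo ↔
    (∀ (F : Type) [Field F] [NumberField F], IsTotallyComplex F → Module.finrank ℚ F = 2 →
      ∀ (p : ℕ) [Fact p.Prime], p ≠ 2 →
      ∀ M : ModelData F p, M.IsSWOriented p →
        ClosedPointStratumLE M.𝓡 3 → M.AtMostTwoAlignedPlaces p → SmallReducibleLocus M.𝓡) := Iff.rfl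

theorem stub_seedResidualTransport_iff : S.stub_seedResidualTransport ↔
    (∀ (F : Type) [Field F] [NumberField F], IsTotallyComplex F → Module.finrank ℚ F = 2 →
      ∀ (p : ℕ) [Fact p.Prime], p ≠ 2 →
      ∀ (O : ValuationSubring (PadicAlgCl p)),
        O = (Valued.v : Valuation (PadicAlgCl p) NNReal).valuationSubring →
      ∀ (ρ : FramedGaloisRep F (PadicAlgCl p) 2) (ρ₀ : absoluteGaloisGroup F →* GL (Fin 2) O),
        ρ.toGaloisRep.IsIrreducible → (∀ᶠ v in cofinite, ρ.IsUnramifiedAt v) →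
        ρ.HasUpperTriangularIntegralModel ρ₀ → OrdLoc p O ρ ρ₀ →
      ∀ (𝒰 : TameLevel 2 F p) (r : FramedGaloisRep F (PadicAlgCl p) 2)
        (r₀ : absoluteGaloisGroup F →* GL (Fin 2) O) (q : HeightOneSpectrum (𝓞 F)), SeedData p ρ₀ 𝒰 r r₀ q →
      ∀ M : ModelData F p, M.Models ρ ρ₀ (baseLevel ρ ∪ {q}) → M.IsLocalPoint → SmallReducibleLocus M.𝓡 →
        ∃ (L : IntermediateField ℚ_[p] (PadicAlgCl p)) (_ : FiniteDimensional ℚ_[p] L)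
            (ι : M.𝒪 →+* intermediateFieldIntegers p L)
            (κ : M.k →+* IsLocalRing.ResidueField (intermediateFieldIntegers p L))
            (_ : ∀ o, κ (algebraMap M.𝒪 M.k o) = IsLocalRing.residue (intermediateFieldIntegers p L) (ι o))
            (rL : absoluteGaloisGroup F →* GL (Fin 2) (intermediateFieldIntegers p L)) (P : GL (Fin 2) (PadicAlgCl p)),
            (Matrix.GeneralLinearGroup.map (IsLocalRing.residue (intermediateFieldIntegers p L))).comp rL =
                (Matrix.GeneralLinearGroup.map κ).comp M.𝒟.residual ∧
            (∀ v : HeightOneSpectrum (𝓞 F), (p : 𝓞 F) ∈ v.asIdeal →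
              ∃ PL : GL (Fin 2) (intermediateFieldIntegers p L),
                Matrix.GeneralLinearGroup.map (IsLocalRing.residue (intermediateFieldIntegers p L)) PL =
                  Matrix.GeneralLinearGroup.map κ (M.𝒟.frame v) ∧
                ∀ σ, (PL⁻¹ * rL (absGaloisRestrict F (v.adicCompletion F) σ) * PL).val 1 0 = 0) ∧
            ∀ g, Matrix.GeneralLinearGroup.map
              ((algebraMap L (PadicAlgCl p)).comp (intermediateFieldIntegers p L).subtype) (rL g) = P⁻¹ * r g * P) := Iff.rfl

theorem stub_seedPatchingPrime_iff : S.stub_seedPatchingPrime ↔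
    (∀ (F : Type) [Field F] [NumberField F], IsTotallyComplex F → Module.finrank ℚ F = 2 →
      ∀ (p : ℕ) [Fact p.Prime], p ≠ 2 →
      ∀ (O : ValuationSubring (PadicAlgCl p)),
        O = (Valued.v : Valuation (PadicAlgCl p) NNReal).valuationSubring →
      ∀ (ρ : FramedGaloisRep F (PadicAlgCl p) 2) (ρ₀ : absoluteGaloisGroup F →* GL (Fin 2) O),
        ρ.toGaloisRep.IsIrreducible → (∀ᶠ v in cofinite, ρ.IsUnramifiedAt v) →
        ρ.HasUpperTriangularIntegralModel ρ₀ → OrdLoc p O ρ ρ₀ →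
      ∀ (𝒰 : TameLevel 2 F p) (r : FramedGaloisRep F (PadicAlgCl p) 2)
        (r₀ : absoluteGaloisGroup F →* GL (Fin 2) O) (q : HeightOneSpectrum (𝓞 F)), SeedData p ρ₀ 𝒰 r r₀ q →
      ∀ M : ModelData F p, M.Models ρ ρ₀ (baseLevel ρ ∪ {q}) → M.IsLocalPoint → SmallReducibleLocus M.𝓡 →
        ∃ 𝔭 : PrimeSpectrum M.𝓡.R, IsPatchingPrime M.𝓡 𝔭 ∧ IsProModularPrime M.𝓡 𝔭) := Iff.rfl

theorem stub_cmPresentation_iff : S.stub_cmPresentation ↔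
    (∀ (F : Type) [Field F] [NumberField F], IsTotallyComplex F → Module.finrank ℚ F = 2 →
      ∀ (p : ℕ) [Fact p.Prime], p ≠ 2 →
      ∀ M : ModelData F p, M.IsSWOriented p →
        (∀ X : Matrix (Fin 2) (Fin 2) M.k, (∀ g : absoluteGaloisGroup F,
          (ZMod.castHom (dvd_refl p) M.k (PadicInt.toZMod ((GaloisRep.cyclotomicCharacter F p g : ℤ_[p]ˣ) : ℤ_[p]))) •
            ((M.𝒟.residual g).val * X) = X * (M.𝒟.residual g).val) → X = 0) →
        (∃ (A : Type) (_ : CommRing A) (_ : IsNoetherianRing A) (_ : IsLocalRing A)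
            (_ : IsAdicComplete (IsLocalRing.maximalIdeal A) A) (rs : List A) (I : Ideal A) (_ : M.𝓡.R ≃+* A ⧸ I),
            (∀ r ∈ rs, r ∈ IsLocalRing.maximalIdeal A) ∧ RingTheory.Sequence.IsRegular A rs ∧
              (rs.length : WithBot ℕ∞) = ringKrullDim A ∧ ((4 : ℕ) : WithBot ℕ∞) + I.spanFinrank ≤ ringKrullDim A)) := Iff.rfl

theorem stub_raynaudConnectedness_iff : S.stub_raynaudConnectedness ↔
    (∀ (R : Type) [CommRing R] (A : Type) [CommRing A] [IsNoetherianRing A] [IsLocalRing A]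
      [IsAdicComplete (IsLocalRing.maximalIdeal A) A] (rs : List A),
      (∀ r ∈ rs, r ∈ IsLocalRing.maximalIdeal A) → RingTheory.Sequence.IsRegular A rs →
      (rs.length : WithBot ℕ∞) = ringKrullDim A →
      ∀ (I : Ideal A) (_ : R ≃+* A ⧸ I) (n : ℕ), ((n + 1 : ℕ) : WithBot ℕ∞) + I.spanFinrank ≤ ringKrullDim A →
      ∀ S : Set (PrimeSpectrum R),
        (∃ C ∈ S, C.asIdeal ∈ minimalPrimes R) → (∃ C ∉ S, C.asIdeal ∈ minimalPrimes R) →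
          ∃ C₁ ∈ S, ∃ C₂ ∉ S, C₁.asIdeal ∈ minimalPrimes R ∧ C₂.asIdeal ∈ minimalPrimes R ∧
            (n : WithBot ℕ∞) ≤ ringKrullDim (R ⧸ (C₁.asIdeal ⊔ C₂.asIdeal))) := Iff.rfl

theorem stub_crossingsAreBig_iff : S.stub_crossingsAreBig ↔
    (∀ (F : Type) [Field F] [NumberField F], IsTotallyComplex F → Module.finrank ℚ F = 2 →
      ∀ (p : ℕ) [Fact p.Prime], p ≠ 2 →
      ∀ M : ModelData F p, M.IsSWOriented p → SmallReducibleLocus M.𝓡 →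
        (∃ (A : Type) (_ : CommRing A) (_ : IsNoetherianRing A) (_ : IsLocalRing A)
            (_ : IsAdicComplete (IsLocalRing.maximalIdeal A) A) (rs : List A) (I : Ideal A) (_ : M.𝓡.R ≃+* A ⧸ I),
            (∀ r ∈ rs, r ∈ IsLocalRing.maximalIdeal A) ∧ RingTheory.Sequence.IsRegular A rs ∧
              (rs.length : WithBot ℕ∞) = ringKrullDim A ∧ ((4 : ℕ) : WithBot ℕ∞) + I.spanFinrank ≤ ringKrullDim A) →
        ∀ C₁ C₂ : PrimeSpectrum M.𝓡.R, C₁.asIdeal ∈ minimalPrimes M.𝓡.R → C₂.asIdeal ∈ minimalPrimes M.𝓡.R →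
          C₁ ≠ C₂ → ∀ Q : PrimeSpectrum M.𝓡.R, Q.asIdeal ∈ (C₁.asIdeal ⊔ C₂.asIdeal).minimalPrimes →
            ((3 : ℕ) : WithBot ℕ∞) ≤ ringKrullDim (M.𝓡.R ⧸ Q.asIdeal) →
              IsBigPrime M.𝓡 Q ∧
              (∀ (v : HeightOneSpectrum (𝓞 F)) (hv : (p : 𝓞 F) ∈ v.asIdeal),
              ¬ IsOfFinOrder ((Units.map (Ideal.Quotient.mk Q.asIdeal : M.𝓡.R →* M.𝓡.R ⧸ Q.asIdeal)).comp
                (M.𝓡.subChar v hv / M.𝓡.quotChar v hv)))) := Iff.rfl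

theorem stub_descentFromPatchingPrime_iff : S.stub_descentFromPatchingPrime ↔
    (∀ (F : Type) [Field F] [NumberField F], IsTotallyComplex F → Module.finrank ℚ F = 2 →
      ∀ (p : ℕ) [Fact p.Prime], p ≠ 2 →
      ∀ M : ModelData F p, M.IsSWOriented p →
        ∀ 𝔭 : PrimeSpectrum M.𝓡.R, IsPatchingPrime M.𝓡 𝔭 → IsProModularPrime M.𝓡 𝔭 →
          ∀ 𝔮 : PrimeSpectrum M.𝓡.R, 𝔮 ≤ 𝔭 → IsProModularPrime M.𝓡 𝔮) := Iff.rfl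

theorem stub_largeResidualRank_iff : S.stub_largeResidualRank ↔
    (∀ (F : Type) [Field F] [NumberField F], IsTotallyComplex F → Module.finrank ℚ F = 2 →
      ∀ (p : ℕ) [Fact p.Prime], p ≠ 2 →
      ∀ (O : ValuationSubring (PadicAlgCl p)),
        O = (Valued.v : Valuation (PadicAlgCl p) NNReal).valuationSubring →
      ∀ (ρ : FramedGaloisRep F (PadicAlgCl p) 2) (ρ₀ : absoluteGaloisGroup F →* GL (Fin 2) O),
        ρ.toGaloisRep.IsIrreducible → (∀ᶠ v in cofinite, ρ.IsUnramifiedAt v) →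
        ρ.HasUpperTriangularIntegralModel ρ₀ → OrdLoc p O ρ ρ₀ →
      ∀ (q : HeightOneSpectrum (𝓞 F)) (M : ModelData F p), M.Models ρ ρ₀ (baseLevel ρ ∪ {q}) → M.IsLocalPoint →
        ¬ (ClosedPointStratumLE M.𝓡 3 ∧ M.AtMostTwoAlignedPlaces p ∧
          (∀ X : Matrix (Fin 2) (Fin 2) M.k, (∀ g : absoluteGaloisGroup F,
          (ZMod.castHom (dvd_refl p) M.k (PadicInt.toZMod ((GaloisRep.cyclotomicCharacter F p g : ℤ_[p]ˣ) : ℤ_[p]))) •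
            ((M.𝒟.residual g).val * X) = X * (M.𝒟.residual g).val) → X = 0)) → ProMod p ρ) := Iff.rfl

end

end Summit.Langlands.Langlands.Cruxes.ReducibleOrdinaryProModular.FineSelmerCodimensionTwo
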